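import Literature.Computability.QuantumComplexity.RandomOracleMeasure
import Literature.Computability.Cryptography.ClassBQP
import Literature.Computability.Cryptography.OracleGames
import Literature.Computability.Complexity.Oracle
import Literature.Computability.Complexity.PolyHierarchy
import HarnessLib

-- provenance: harness21/H21/H21/Statements/QuantumAdvantage/OracleSeparations.lean @ d20076f (interim HEAD d8f2665); M5 mechanical rewrite
/-!
# Quantum advantage: oracle separations

Family `quantum-advantage` (trunk `CryptoQuantFine`, outline §3, item `QAOracles`), statements
**quantum-advantage.S13**, **S14**, **S24**, in the family namespace `Literature.QuantumAdvantage`.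

* `exists_oracle_BQPRel_subset_BPPRel` (folklore via Bernstein–Vazirani §8: `BQP^A ⊆ PSPACE^A`
  relativizes; take `A` `PSPACE`-complete): there is an oracle `A` with `BQP^A ⊆ BPP^A` — the
  other half of the relativization barrier;
* **quantum-advantage.S13** `exists_oracle_BQPRel_not_subset_BPPRel`: there is an oracle `A`
  with `BQP^A ⊄ BPP^A` (Bernstein–Vazirani 1997, §8.4, recursive Fourier sampling; Simon 1997).
  The literature strengthening `BQP^A ⊄ MA^A` is *not* stated: the complexity core G01 has no
  class `MA`.
* **quantum-advantage.S14** `exists_oracle_BQPRel_not_subset_PHRel`: there is an oracle `A`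
  with `BQP^A ⊄ PH^A` (Raz–Tal 2022, Thm. 1.1 and its Corollary 1.5).
* **quantum-advantage.S24** `yamakawa_zhandry`: relative to a *random* oracle `A`, with
  probability `1` there is an `NP^A` search problem which is solvable in `BQP^A` (as a search
  problem) but not in `BPP^A` (Yamakawa–Zhandry, FOCS 2022; arXiv:2204.02063, Cor. 1.3). The random oracle is a
  uniformly random language `A ⊆ {0,1}*` (each string belongs to `A` independently with
  probability `1/2`), i.e. a sample of Mathlib's `setBer(Set.univ, 1/2)` — the tree's
  `randomOracle` (fact-free module `RandomOracleMeasure.lean`), spelled here through its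
  reducible synonym `randomOracleMeasure`.

## Mathlib / H21 dependencies

Mathlib: the random oracle *is* in Mathlib, as the product Bernoulli measure on sets
`ProbabilityTheory.setBernoulli` (`Mathlib/Probability/Distributions/SetBernoulli.lean`,
notation `setBer(u, p)`, with its `IsProbabilityMeasure` instance and API
`setBernoulli_apply`, `setBernoulli_ae_subset`, …); we use it with `u = Set.univ`, `p = 1/2`
and carrier `Set (List Bool)` (there is no `MeasurableSpace (Language Bool)` instance and we do
not add one; `Language Bool` is definitionally `Set (List Bool)`, so samples are used as
languages by ascription). Also `Language`, `List.IsPrefix` (`<+:`), `PMF.toOuterMeasure`,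
`Computability.encodingList`. Mathlib has no complexity classes (searched: `BQP`, `BPP`,
`oracle` in `Mathlib/Computability`).

H21: `BQPRel`, `IsQSolvableRel` (Q3 `ClassBQP`); `OracleAdversary`, `OracleAdversary.IsPPT`,
`OracleAdversary.outputPMF` (C4a `OracleGames`); `Oracle`, `Oracle.ofLanguage`, `PRel`, `BPPRel`
(G01 `Oracle`); `PHRel` (G01 `PolyHierarchy`); `boolPair` (G01 `BoolEncodings`).

## Design choices

* Quantum oracle classes take the oracle as a language `A : Language Bool` (Q2's oracle gate is
  the XOR query `|q,b⟩ ↦ |q, b ⊕ [q ∈ A]⟩`), classical ones take G01's function oracle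
  `Oracle = List Bool → List Bool`; the bridge is `Oracle.ofLanguage A` (answer bit
  `[q ∈ A]`). All three statements quantify over *language* oracles, which is what the cited
  constructions produce.
* S24: search problems are `R : List Bool → Set (List Bool)` (on input `x`, output some
  `y ∈ R x`), the bundling of Q3's `IsQSolvableRel`. An `NP^A` search problem is one whose
  witnesses are polynomially bounded and whose graph is decidable in `P^A` on pairs
  `boolPair x y` (`IsNPSearchRel`). "Solvable in `BQP^A`" is Q3's `IsQSolvableRel` applied to
  the prefix closure `prefixClosure R` (the family measures all its wires; some witness must be a
  *prefix* of the measured string, Q3's `FBQP` output convention). "Solvable in `BPP^A`" is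
  `IsBPPSolvableRel`: a PPT oracle adversary (C4a) outputs a witness with probability `≥ 2/3` on
  every input that has one (the standard search-`BPP` definition; the guard is vacuous for total
  problems). Totality of the Yamakawa–Zhandry problem is *not* asserted: the inventory text
  speaks of NP search problems, not TFNP.
* The random oracle measure is DEFINED in the fact-free module `RandomOracleMeasure.lean` as
  `randomOracle := setBer(Set.univ, 1/2)` (deviating from the outline's `infinitePi` of fair coins
  on `List Bool → Bool`, written before `setBernoulli` was located; the two agree along
  `O ↦ {x | O x}`), so that routes and files which only need the measure do not import this
  file's facts. The older name `randomOracleMeasure`, first declared here and used by this file's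
  importers (`RandomOracleCylinders`, `AlmostP`, `RandomOraclePH`, `AaronsonAmbainisThm23*`,
  `Barriers/QuantumAdvantage/RandomOracleMethod*`, …), is kept as a reducible synonym
  (`abbrev randomOracleMeasure := randomOracle`, so `randomOracleMeasure = randomOracle` is
  `rfl`, even `with_reducible rfl`), together with its named `IsProbabilityMeasure` instance;
  the gate pins a fully-qualified name to its first module, so the name itself cannot move.
-/

open MeasureTheory Computability ProbabilityTheory Literature.Computability.Complexity Literature.Computability.Cryptography

namespace Literature.Computability.QuantumComplexity

/-! ### S13, S14: BQP versus BPP and PH relative to an oracle -/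

/-- **quantum-advantage.S13** (Bernstein–Vazirani 1997, §8.4 (Thm. 8.4.2, recursive Fourier
sampling); Simon 1997, Thm. 3.3). There is an oracle `A ⊆ {0,1}*` relative to which
bounded-error quantum polynomial time is not contained in bounded-error probabilistic
polynomial time: `BQP^A ⊄ BPP^A`. The strengthening `BQP^A ⊄ MA^A` (Bernstein–Vazirani, via
Babai) is not stated because G01 has no class `MA`. [cite: BernsteinVazirani1997, §8.4 (Thm. 8.4.2  recursive Fourier samp] -/
def exists_oracle_BQPRel_not_subset_BPPRel : Prop :=
  ∃ A : Language Bool, ¬ BQPRel A ⊆ BPPRel (Oracle.ofLanguage A)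

/-- **quantum-advantage.S14** (Raz–Tal, *Oracle separation of BQP and PH*, J. ACM 69 (2022),
Thm. 1.1 with Cor. 1.5). There is an oracle `A ⊆ {0,1}*` relative to which bounded-error
quantum polynomial time is not contained in the polynomial hierarchy: `BQP^A ⊄ PH^A`
(Raz–Tal, Cor. 1.5: "There exists an oracle `O` relative to which `BQP^O ⊄ PH^O`", from the
Forrelation distribution bounds Thms. 1.1–1.2). [cite: RazTal2022, Cor. 1.5] -/
def exists_oracle_BQPRel_not_subset_PHRel : Prop :=
  ∃ A : Language Bool, ¬ BQPRel A ⊆ PHRel (Oracle.ofLanguage A)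

/-- **Relativization barrier for `BQP` versus `BPP`, collapsing direction** (folklore;
Bernstein–Vazirani 1997, §8 ("`BQP ⊆ P^{#P} ⊆ PSPACE`"), whose proof relativizes:
`BQP^A ⊆ PSPACE^A` for every oracle `A`; hence for a `PSPACE`-complete language `A` one has
`BQP^A ⊆ PSPACE^A = P^A ⊆ BPP^A`). There is an oracle `A ⊆ {0,1}*` relative to which
bounded-error quantum polynomial time is contained in bounded-error probabilistic polynomial time:
`BQP^A ⊆ BPP^A` (so `BQP^A = BPP^A`, as `BPP^B ⊆ BQP^B` for every `B`). Together with
`exists_oracle_BQPRel_not_subset_BPPRel` (`BQP^B ⊄ BPP^B` for some `B`) this shows that neither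
`BQP = BPP` nor `BQP ≠ BPP` has a relativizing proof. Wanted by routes `QuantumAdvantage/CircuitLB`,
`Shor`, `Dequantize`. [cite: BernsteinVazirani1997, §8 (BQP ⊆ P^{#P} ⊆ PSPACE, relativizing)]
[folklore] -/
def exists_oracle_BQPRel_subset_BPPRel : Prop :=
  ∃ A : Language Bool, BQPRel A ⊆ BPPRel (Oracle.ofLanguage A)

/-- The two oracle facts together: `BQP` versus `BPP` is independent of relativizing techniques
(there are oracles making the classes equal and oracles separating them). [folklore] -/
theorem bqp_bpp_relativization_barrier (h₁ : exists_oracle_BQPRel_subset_BPPRel)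
    (h₂ : exists_oracle_BQPRel_not_subset_BPPRel) :
    (∃ A : Language Bool, BQPRel A ⊆ BPPRel (Oracle.ofLanguage A)) ∧
      ∃ B : Language Bool, ¬ BQPRel B ⊆ BPPRel (Oracle.ofLanguage B) :=
  ⟨h₁, h₂⟩

/-! ### S24: NP search problems relative to a random oracle -/

/-- The **random oracle** measure, older synonym: the law of a uniformly random language
`A ⊆ {0,1}*`, each string belonging to `A` independently with probability `1/2` — Mathlib's
product Bernoulli measure on sets `setBer(Set.univ, 1/2)` on the carrier `Set (List Bool)`
(samples are used as `Language Bool` by definitional unfolding). This is a REDUCIBLE SYNONYM of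
`Literature.Computability.QuantumComplexity.randomOracle` (fact-free module
`RandomOracleMeasure.lean`, the definition to use in new statements): `randomOracleMeasure =
randomOracle` holds by `rfl` (reducibly), so every statement and every lemma written with either
name applies to the other. Kept under this name because the importers of this file use it.
[Bennett–Gill, SIAM J. Comput. 10 (1981), §1 (random oracles); Yamakawa–Zhandry 2022
(arXiv:2204.02063), §2 "Classical/quantum random oracle model" and §3 ¶2 (oracles
`H : {0,1}* → {0,1}` identified with infinite bit strings; "a random oracle is the oracle
associated with a random infinite-length bit-string")]
[cite: YamakawaZhandry2022FOCS, §2 (CROM/QROM) and §3 ¶2 (arXiv:2204.02063 numbering)] -/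
noncomputable abbrev randomOracleMeasure : Measure (Set (List Bool)) :=
  randomOracle

/-- The synonym unfolds to the definition: `randomOracleMeasure = randomOracle`. [folklore] -/
theorem randomOracleMeasure_eq_randomOracle : randomOracleMeasure = randomOracle :=
  rfl

/-- The random oracle measure is a probability measure (the instance of the home module,
transported along the reducible synonym; Mathlib's instance for `setBernoulli`).
[Bennett–Gill 1981, §1] [cite: BennettGill1981, §1] -/
instance isProbabilityMeasure_randomOracleMeasure : IsProbabilityMeasure randomOracleMeasure :=
  isProbabilityMeasure_randomOracle

/-- `IsNPSearchRel A R`: the search problem `R` (on input `x`, output some `y ∈ R x`) is an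
**NP search problem relative to the oracle language `A`** — witnesses are polynomially bounded
(`y ∈ R x → |y| ≤ p |x|`) and the graph is decidable in `P^A` on encoded pairs `boolPair x y`.
[Yamakawa–Zhandry 2022 (arXiv:2204.02063), Cor. 1.3 ("an NP search problem") with Def. 6.1 (the
verifier `Verify^H(1^λ, π)`: "a deterministic classical polynomial-time algorithm that ... makes
poly(λ) queries to the random oracle `H`"); Bellare–Goldwasser 1994, §1; Arora–Barak 2009,
Def. 2.1 with §5.5] [cite: YamakawaZhandry2022FOCS, Cor. 1.3 with Def. 6.1 (arXiv:2204.02063 numbering)] -/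
def IsNPSearchRel (A : Language Bool) (R : List Bool → Set (List Bool)) : Prop :=
  (∃ p : Polynomial ℕ, ∀ x, ∀ y ∈ R x, y.length ≤ p.eval x.length) ∧
    {z | ∃ x, ∃ y ∈ R x, z = boolPair x y} ∈ PRel (Oracle.ofLanguage A)

/-- `prefixClosure R`: the search problem "output a string of which some witness `y' ∈ R x` is a
prefix". This is Q3's `FBQP` output convention for circuit families measured on all wires (the
answer sits on the leading wires, the rest is workspace). [Aaronson 2010, §1 (FBQP);
cf. `Literature.Computability.Cryptography.FBQP`] [cite: Aaronson2010, §1 (FBQP] -/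
def prefixClosure (R : List Bool → Set (List Bool)) (x : List Bool) : Set (List Bool) :=
  {y | ∃ y' ∈ R x, y' <+: y}

/-- Every witness lies in the prefix closure. [Aaronson 2010, §1] [cite: Aaronson2010, §1] -/
theorem subset_prefixClosure (R : List Bool → Set (List Bool)) (x : List Bool) :
    R x ⊆ prefixClosure R x :=
  fun y hy => ⟨y, hy, List.prefix_refl y⟩

/-- `IsBPPSolvableRel A R`: the search problem `R` is **solvable in `BPP^A`** — some
probabilistic polynomial-time oracle algorithm (`OracleAdversary`, outputs strings, oracle
`Oracle.ofLanguage A`), on every input `x` having a witness, outputs some `y ∈ R x` with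
probability at least `2/3` (the guard `(R x).Nonempty` is the standard one for partial search
problems and is vacuous for total ones). [Yamakawa–Zhandry 2022 (arXiv:2204.02063), Cor. 1.3
("not by BPP machines") with §3 (uniform oracle-dependent adversaries: polynomially many
classical queries in the input length) and Def. 6.1 (`(Q, ε)`-soundness against `Q`-query
classical adversaries); Arora–Barak 2009, Def. 7.1 with §3.4]
[cite: YamakawaZhandry2022FOCS, Cor. 1.3 with §3 and Def. 6.1 (arXiv:2204.02063 numbering)] -/
def IsBPPSolvableRel (A : Language Bool) (R : List Bool → Set (List Bool)) : Prop :=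
  ∃ 𝒜 : OracleAdversary (List Bool), 𝒜.IsPPT (encodingList Bool) ∧
    ∀ x, (R x).Nonempty →
      2 / 3 ≤ ((𝒜.outputPMF (Oracle.ofLanguage A) x).toOuterMeasure (some '' R x)).toReal

/-- **quantum-advantage.S24** (Yamakawa–Zhandry, *Verifiable quantum advantage without
structure*, FOCS 2022 (IEEE proc. pp. 69–74); full version arXiv:2204.02063, **Cor. 1.3**: "Relative
to a random oracle, there exists an NP search problem that is solvable by BQP machines but not by
BPP machines" — the first bullet of the abstract, "relative to a random oracle with probability
1", obtained from Thm. 1.2 = Thm. 6.2 (a keyless proof of quantumness in the QROM, sound against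
uniform oracle-dependent adversaries) via Thm. 3.6 (oracle-independent ⇒ uniform oracle-dependent
security with probability `1` over the oracle, by countability of the machines)). Relative to a
random oracle `A ⊆ {0,1}*`, with probability `1` there is an NP search problem `R` relative to
`A` which is solvable by a poly-time uniform quantum circuit family with oracle `A` (some witness
is a prefix of the measured output with probability `≥ 2/3`, Q3's `IsQSolvableRel` on
`prefixClosure R`), and is *not* solvable by any probabilistic polynomial-time oracle machine
with oracle `A` (`IsBPPSolvableRel`): `NP`-search-`BQP^A ⊄` search-`BPP^A` for a random `A`.
The printed search problem is `R(1^λ) = {x⃗ ∈ C_λ | H_i(x⃗_i) = 1 for all i ∈ [n]}` for the folded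
Reed–Solomon codes `C_λ` of Lemma 4.2 (list-recoverable, Rudra/Guruswami–Rudra; dual decodable
from half-density random errors, Guruswami–Sudan), §6.1. (Earlier tree text cited this as
"Thm. 1.1" under the key `FOCS2022`, which `references.bib` resolves to a different FOCS 2022
paper; the statement is unchanged.) [cite: YamakawaZhandry2022FOCS, Cor. 1.3 with Thm. 6.2 and Thm. 3.6 (arXiv:2204.02063 numbering)] -/
def yamakawa_zhandry : Prop :=
  ∀ᵐ A ∂randomOracleMeasure, ∃ R : List Bool → Set (List Bool),
      IsNPSearchRel (A : Language Bool) R ∧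
      IsQSolvableRel (A : Language Bool) (prefixClosure R) ∧
      ¬ IsBPPSolvableRel (A : Language Bool) R

end Literature.Computability.QuantumComplexity
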